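/-
Copyright (c) 2026 the pub-hodgecm-mathlib formalisation cell (harness21).  Prover seat hodgecm-mathlib-K2E3-p29 (g4), Track B ∕ R90-TF, h413 = `stmt-HodgeConjecture-24833`,
R90-TF section S8 «ContSpec-n½» (S8 dealer R90-CS-plan (g4) S8-R258 (1)): FILE 2a of the axis letters — the two ENGINE LEMMAS behind the off-axis boundedness of the continued scattering
coordinates ([MoeglinWaldspurger1995, IV.1.11]): the pure box bound on the fourth bracket of the Maass–Selberg diagonal identity at one off-axis point, and the `L²(K_max)`-model of
bounded continuous columns (Gram form = a squared norm, Cauchy–Schwarz for the cross scalar, norm domination of the coordinates).  Consumed by FILE 2b `R90S8ResGMidTauOffAxisBoundOfGramU3`.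
-/
import Summits.HodgeConjecture.HodgeConjecture.Theorems.K2E1MaassSelbergPoleControl                 -- ★ (K2E1 lineage): `poleControl_of_fourTerm` — the pure four-term inequality (a1)(a2)(a3)
import Summits.HodgeConjecture.HodgeConjecture.Theorems.K2E1ChiScatteringRealPolesM1CMTwo          -- ★ p860605 (rank 2): `exists_norm_apply_le_norm_sum_smul` (coordinates against an independent family are norm-dominated)
import Summits.HodgeConjecture.HodgeConjecture.Theorems.K2E1ChiScatteringRealPolesOfModelM1CMTwo   -- ★ p860653 (rank 2): `coeFn_sum_smul_ae` (a.e. representative of a finite `Lp`-combination)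
import Literature.NumberTheory.Automorphic.UnitaryGroupIwasawaIntegration                          -- `isCompact_comap_adelicVal_standardMaximalCompactGL` (`K_max` is compact)
import HarnessLib

/-!
# S8 (R)′ road — `R90S8ResGMidTauOffAxisGramModelU3`: THE BOX BOUND ON THE FOURTH BRACKET AND THE `L²(K_max)`-MODEL OF THE COLUMNS (engine of [MW95 IV.1.11] off the axis)

Track B ∕ R90-TF, crux h413 = `stmt-HodgeConjecture-24833`, route of record `HCCMUnconditional`; cell `hodgecm-mathlib`, R90-TF section S8 «ContSpec-n½ ∕ ResidualSpectrum», sub-socket (R)′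
(B ED. 7 :337) via K2E2-p12 (g10)'s (R)′τ OF RECORD ★ p865056 — per-generator letter `hPreal`; ★ p865213 reduced it to `hOFFBD` (off-axis boundedness of the continued coordinates), and
FILE 2b pays `hOFFBD` from the two lemmas of this file.  THEOREMS ONLY (no `def`, no `instance`, no `notation`, no named-fact hypothesis, no `sorry`; default heartbeats); lane
`--supports stmt-HodgeConjecture-24833 --as helper` (count-neutral).  CLOSES NO SOCKET.

THE MATHEMATICS ([MoeglinWaldspurger1995, IV.2.3, IV.3.12 (a)]; [Arthur1980TraceFormulaII, §4]; [Rudin1987, Thm. 4.2 (Cauchy–Schwarz)]).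
* §1 (pure) **`bracket_le_of_chiFourTerm_offAxis`** — from the diagonal four-term identity
  `Q = c₁·c₂·(T^{z+z̄−2}∕(z+z̄−2)·a + T^{z−z̄}∕(z−z̄)·W − T^{−(z−z̄)}∕(z−z̄)·conj W − T^{−(z+z̄−2)}∕(z+z̄−2)·b)` with `Q ≥ 0`, `c₁, c₂ > 0`, `T ≥ 1`, `Re z > 1`, `Im z ≠ 0`, `a, b ≥ 0` and
  Cauchy–Schwarz `‖W‖² ≤ a·b`, on the box `Re z − 1 ∈ [x₁, x₂]` (`x₁ > 0`), `|Im z| ≥ η > 0` the fourth bracket obeys `b ≤ (x₂T^{2x₂}√a∕η + √(x₂²T^{4x₂}a∕η² + aT^{4x₂}))²`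
  (★ `poleControl_of_fourTerm` (a2) when `a > 0`; when `a = 0`, `W = 0` and the identity reads `Q = −c₁c₂T^{−2x}∕(2x)·b ≤ 0`, so `b = 0`).
* §2 (the `L²(K_max)`-model) **`l2Model_of_columns`** — for continuous bounded columns `φ'_j` LINEARLY INDEPENDENT ON `K_max` and a continuous bounded `φ`, with
  `N(q) := ∫_{K_max} ‖Σ_j q_j φ'_j‖² dμ_K`: (i) `Σ_{j,l} q_j conj q_l ∫ φ'_j conj φ'_l dμ_K = N(q)` (so the Gram form is REAL and `≥ 0`); (ii) `‖Σ_j q_j ∫ φ'_j conj φ dμ_K‖² ≤ (∫ ‖φ‖² dμ_K)·N(q)`;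
  (iii) `‖q_j‖² ≤ C·N(q)` with ONE `C ≥ 0` — in `L²(μ_K)` the classes `bK_j` of the columns are linearly independent (a vanishing combination vanishes a.e., hence everywhere by continuity
  and the full support of the Haar measure `μ_K` on the compact group `K_max`), so ★ `exists_norm_apply_le_norm_sum_smul` dominates the coordinates by `‖Σ_j q_j • bK_j‖ = √N(q)`
  (★ `coeFn_sum_smul_ae` identifies the representative).
HONEST LABEL: HC_CM is proved only modulo the 7 printed citations (2 remaining named inputs: hLiu418 = `stmt-HodgeConjecture-24832`, h413 = `stmt-HodgeConjecture-24833`) until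
rung 0 closes; this file is pure analysis on the Maass–Selberg letters; pays no socket; count-neutral.

## References
* [MoeglinWaldspurger1995] C. Mœglin, J.-L. Waldspurger, *Spectral Decomposition and Eisenstein Series* (1995), IV.1.11, IV.2.3, IV.3.12 (a).
* [Arthur1980TraceFormulaII] J. Arthur, *A trace formula for reductive groups II*, Compositio Math. 40 (1980), §4 (the four-term Maass–Selberg inner product).
* [Rudin1987] W. Rudin, *Real and Complex Analysis* (3rd ed., 1987), Thm. 4.2 (Cauchy–Schwarz in an inner-product space).
-/


set_option autoImplicit false
set_option linter.dupNamespace false  -- the mandated namespace `…HodgeConjecture.HodgeConjecture.R90.S8` (LEAD #1 L1) repeats the summit's segment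

noncomputable section

open MeasureTheory Measure NumberField IsDedekindDomain Set Filter Topology ContRepresentation Complex
open scoped ENNReal NNReal ComplexConjugate InnerProductSpace Topology
open Literature.NumberTheory Literature.NumberTheory.Automorphic Literature.NumberTheory.Automorphic.UnitaryGroup AdelicGroupData
open Summit.HodgeConjecture.HodgeConjecture.Cruxes.H413.K2E1MaassSelbergPoleControl (poleControl_of_fourTerm)
open Summit.HodgeConjecture.HodgeConjecture.Cruxes.H413.K2E1ChiScatteringRealPolesM1CMTwo (exists_norm_apply_le_norm_sum_smul)
open Summit.HodgeConjecture.HodgeConjecture.Cruxes.H413.K2E1ChiScatteringRealPolesOfModelM1CMTwo (coeFn_sum_smul_ae)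

namespace Summit.HodgeConjecture.HodgeConjecture.R90.S8

/-! ## §1 The pure box bound on the fourth bracket at one off-axis point -/

/-- **THE FOURTH BRACKET IS BOUNDED ON AN OFF-AXIS BOX** ([MW95] IV.3.12 (a) read at one point): from the diagonal four-term identity
`Q = c₁·c₂·(T^{z+z̄−2}∕(z+z̄−2)·a + T^{z−z̄}∕(z−z̄)·W − T^{−(z−z̄)}∕(z−z̄)·conj W − T^{−(z+z̄−2)}∕(z+z̄−2)·b)` with `Q ≥ 0`, `c₁, c₂ > 0`, `T ≥ 1`, `Re z > 1`, `Im z ≠ 0`, `a ≥ 0`, `b ≥ 0` and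
Cauchy–Schwarz `‖W‖² ≤ a·b`: on the box `Re z − 1 ∈ [x₁, x₂]` (`x₁ > 0`), `|Im z| ≥ η > 0`, `b ≤ (x₂T^{2x₂}√a∕η + √(x₂²T^{4x₂}a∕η² + aT^{4x₂}))²` (★ `poleControl_of_fourTerm` (a2) for
`a > 0`; for `a = 0`, `W = 0` and the identity reads `Q = −c₁c₂T^{−2x}∕(2x)·b ≤ 0`, so `b = 0`). [cite: MoeglinWaldspurger1995, IV.3.12 (a)] [cite: Arthur1980TraceFormulaII, §4] -/
theorem bracket_le_of_chiFourTerm_offAxis {a b Q c₁ c₂ T : ℝ} {z W B₃ B₄ : ℂ}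
    (hc₁ : 0 < c₁) (hc₂ : 0 < c₂) (hT : 1 ≤ T) (hx : 1 < z.re) (hy : z.im ≠ 0) (hQ : 0 ≤ Q) (ha : 0 ≤ a) (hb : 0 ≤ b)
    (hW : ‖W‖ ^ 2 ≤ a * b) (hB₃ : B₃ = conj W) (hB₄ : B₄ = (b : ℂ))
    (hfour : (Q : ℂ) = (c₁ : ℂ) * ((c₂ : ℂ) *
      ((((T : ℂ)) ^ (z + conj z - 2) / (z + conj z - 2)) * (a : ℂ)
          + (((T : ℂ)) ^ (z - conj z) / (z - conj z)) * W
          - (((T : ℂ)) ^ (-(z - conj z)) / (z - conj z)) * B₃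
          - (((T : ℂ)) ^ (-(z + conj z - 2)) / (z + conj z - 2)) * B₄)))
    {x₁ x₂ η : ℝ} (hx₁ : 0 < x₁) (hxI : z.re - 1 ∈ Set.Icc x₁ x₂) (hη : 0 < η) (hyη : η ≤ |z.im|) :
    b ≤ (x₂ * T ^ (2 * x₂) * Real.sqrt a / η + Real.sqrt (x₂ ^ 2 * T ^ (4 * x₂) * a / η ^ 2 + a * T ^ (4 * x₂))) ^ 2 := by
  have hs₁ : z + conj z - 2 = ((2 * (z.re - 1) : ℝ) : ℂ) := by
    apply Complex.ext
    · simp; ring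
    · simp
  have hs₂ : z - conj z = ((2 * z.im : ℝ) : ℂ) * Complex.I := by
    apply Complex.ext
    · simp
    · simp [two_mul]
  rcases ha.eq_or_lt with ha0 | ha0
  · -- degenerate: `a = 0` forces `W = 0`, and then `b = 0`
    subst ha0
    have hW0 : W = 0 := by
      have h : ‖W‖ ^ 2 ≤ 0 := by simpa using hW
      exact norm_eq_zero.1 (by nlinarith [norm_nonneg W])
    subst hB₃ hB₄
    have hTpos : 0 < T := by linarith
    have hpow : (T : ℂ) ^ (-(z + conj z - 2)) = ((T ^ (-(2 * (z.re - 1))) : ℝ) : ℂ) := by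
      rw [hs₁, ← Complex.ofReal_neg, ← Complex.ofReal_cpow hTpos.le]
    rw [hW0, map_zero] at hfour
    have h1 : (Q : ℂ) = -((c₁ : ℂ) * ((c₂ : ℂ) * ((T : ℂ) ^ (-(z + conj z - 2)) / (z + conj z - 2) * (b : ℂ)))) := by
      rw [hfour, Complex.ofReal_zero]; ring
    rw [hpow, hs₁] at h1
    have hreal : Q = -(c₁ * (c₂ * (T ^ (-(2 * (z.re - 1))) / (2 * (z.re - 1)) * b))) := by exact_mod_cast h1
    have hr : 0 < 2 * (z.re - 1) := by linarith
    have hTr : 0 < T ^ (-(2 * (z.re - 1))) := Real.rpow_pos_of_pos hTpos _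
    have hpos : 0 < c₁ * (c₂ * (T ^ (-(2 * (z.re - 1))) / (2 * (z.re - 1)))) := by positivity
    have hb0 : b = 0 := by
      refine le_antisymm ?_ hb
      by_contra hcon
      have hbpos : 0 < b := lt_of_not_ge hcon
      have hneg : Q < 0 := by
        rw [hreal]
        have : c₁ * (c₂ * (T ^ (-(2 * (z.re - 1))) / (2 * (z.re - 1)) * b)) = (c₁ * (c₂ * (T ^ (-(2 * (z.re - 1))) / (2 * (z.re - 1))))) * b := by ring
        rw [this]
        exact neg_neg_of_pos (mul_pos hpos hbpos)
      linarith
    rw [hb0]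
    exact sq_nonneg _
  · exact (poleControl_of_fourTerm (s₁ := z + conj z - 2) (s₂ := z - conj z) (B₁ := (a : ℂ)) hc₁ hc₂ hT (by linarith : 0 < z.re - 1) hy hQ ha0 hb hW hs₁ hs₂ rfl hB₃ hB₄
      hfour).2.1 hx₁ hxI hη hyη

/-! ## §2 The `L²(K_max)`-model of the columns: the Gram form is a squared norm, Cauchy–Schwarz, norm domination of the coordinates -/

section L2Model

variable (L : Type) [Field L] [NumberField L] [IsCMField L]
  [MeasurableSpace (quasiSplit (↥(maximalRealSubfield L)) L (IsCMField.complexConj L) 3).Adelic] [BorelSpace (quasiSplit (↥(maximalRealSubfield L)) L (IsCMField.complexConj L) 3).Adelic]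

/-- **THE `L²(K_max)`-MODEL OF BOUNDED CONTINUOUS COLUMNS INDEPENDENT ON `K_max`**: for the `L²(μ_K)`-classes `bK_j`, `φK` of `φ'_j|_K`, `φ|_K` and `ψ(q) := Σ_j q_j • bK_j`:
(i) `Σ_{j,l} q_j conj q_l ∫ φ'_j conj φ'_l dμ_K = ‖ψ(q)‖²` (REAL, `≥ 0`); (ii) `‖Σ_j q_j ∫ φ'_j conj φ dμ_K‖² ≤ (∫ ‖φ‖² dμ_K)·‖ψ(q)‖²` (Cauchy–Schwarz); (iii) `‖q_j‖² ≤ C·‖ψ(q)‖²` with ONE `C ≥ 0`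
(★ `exists_norm_apply_le_norm_sum_smul`: the `bK_j` are linearly independent — a vanishing combination vanishes a.e. on `K_max`, hence everywhere by continuity and the full support of
the Haar measure, and the columns are independent there); all three stated with `‖ψ(q)‖² = ∫ ‖Σ_j q_j φ'_j‖² dμ_K`. [cite: MoeglinWaldspurger1995, IV.2.3] [cite: Rudin1987, Thm. 10.20] -/
theorem l2Model_of_columns (μK : Measure ↥((standardMaximalCompactGL 3 L).comap (adelicVal (↥(maximalRealSubfield L)) L (IsCMField.complexConj L) 3 ((StdForm.antidiagonal 3).over L)) : Subgroup (quasiSplit (↥(maximalRealSubfield L)) L (IsCMField.complexConj L) 3).Adelic)) [μK.IsHaarMeasure]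
    {ι : Type} [Fintype ι] {φ' : ι → (quasiSplit (↥(maximalRealSubfield L)) L (IsCMField.complexConj L) 3).Adelic → ℂ} (hφ'c : ∀ j, Continuous (φ' j)) (hφ'bd : ∀ j, ∃ C : ℝ, ∀ x, ‖φ' j x‖ ≤ C)
    (hli : LinearIndependent ℂ (fun j (k : ↥((standardMaximalCompactGL 3 L).comap (adelicVal (↥(maximalRealSubfield L)) L (IsCMField.complexConj L) 3 ((StdForm.antidiagonal 3).over L)) : Subgroup (quasiSplit (↥(maximalRealSubfield L)) L (IsCMField.complexConj L) 3).Adelic)) => φ' j (k : (quasiSplit (↥(maximalRealSubfield L)) L (IsCMField.complexConj L) 3).Adelic)))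
    {φ : (quasiSplit (↥(maximalRealSubfield L)) L (IsCMField.complexConj L) 3).Adelic → ℂ} (hφc : Continuous φ) {Cφ : ℝ} (hφC : ∀ x, ‖φ x‖ ≤ Cφ) :
    ∃ C : ℝ, 0 ≤ C ∧ ∀ q : ι → ℂ,
      (∑ j, ∑ l, q j * conj (q l) * ∫ k, φ' j (k : (quasiSplit (↥(maximalRealSubfield L)) L (IsCMField.complexConj L) 3).Adelic) * conj (φ' l (k : (quasiSplit (↥(maximalRealSubfield L)) L (IsCMField.complexConj L) 3).Adelic)) ∂μK) = (((∫ k, ‖∑ j, q j * φ' j (k : (quasiSplit (↥(maximalRealSubfield L)) L (IsCMField.complexConj L) 3).Adelic)‖ ^ 2 ∂μK : ℝ)) : ℂ) ∧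
      0 ≤ ∫ k, ‖∑ j, q j * φ' j (k : (quasiSplit (↥(maximalRealSubfield L)) L (IsCMField.complexConj L) 3).Adelic)‖ ^ 2 ∂μK ∧
      ‖∑ j, q j * ∫ k, φ' j (k : (quasiSplit (↥(maximalRealSubfield L)) L (IsCMField.complexConj L) 3).Adelic) * conj (φ (k : (quasiSplit (↥(maximalRealSubfield L)) L (IsCMField.complexConj L) 3).Adelic)) ∂μK‖ ^ 2 ≤ (∫ k, ‖φ (k : (quasiSplit (↥(maximalRealSubfield L)) L (IsCMField.complexConj L) 3).Adelic)‖ ^ 2 ∂μK) * ∫ k, ‖∑ j, q j * φ' j (k : (quasiSplit (↥(maximalRealSubfield L)) L (IsCMField.complexConj L) 3).Adelic)‖ ^ 2 ∂μK ∧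
      ∀ j, ‖q j‖ ^ 2 ≤ C * ∫ k, ‖∑ j, q j * φ' j (k : (quasiSplit (↥(maximalRealSubfield L)) L (IsCMField.complexConj L) 3).Adelic)‖ ^ 2 ∂μK := by
  classical
  haveI : CompactSpace ↥((standardMaximalCompactGL 3 L).comap (adelicVal (↥(maximalRealSubfield L)) L (IsCMField.complexConj L) 3 ((StdForm.antidiagonal 3).over L)) : Subgroup (quasiSplit (↥(maximalRealSubfield L)) L (IsCMField.complexConj L) 3).Adelic) :=
    isCompact_iff_compactSpace.1 (isCompact_comap_adelicVal_standardMaximalCompactGL (F := ↥(maximalRealSubfield L)) (E := L) (c := IsCMField.complexConj L) (N := 3))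
  haveI : IsFiniteMeasure μK := ⟨isCompact_univ.measure_lt_top⟩
  choose Cb hCb using hφ'bd
  -- the `L²` classes of the columns and of `φ`
  have hmem : ∀ j, MemLp (fun k : ↥((standardMaximalCompactGL 3 L).comap (adelicVal (↥(maximalRealSubfield L)) L (IsCMField.complexConj L) 3 ((StdForm.antidiagonal 3).over L)) : Subgroup (quasiSplit (↥(maximalRealSubfield L)) L (IsCMField.complexConj L) 3).Adelic) => φ' j (k : (quasiSplit (↥(maximalRealSubfield L)) L (IsCMField.complexConj L) 3).Adelic)) 2 μK := fun j =>
    MemLp.of_bound ((hφ'c j).comp continuous_subtype_val).aestronglyMeasurable (Cb j) (Eventually.of_forall fun k => hCb j k)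
  have hmemφ : MemLp (fun k : ↥((standardMaximalCompactGL 3 L).comap (adelicVal (↥(maximalRealSubfield L)) L (IsCMField.complexConj L) 3 ((StdForm.antidiagonal 3).over L)) : Subgroup (quasiSplit (↥(maximalRealSubfield L)) L (IsCMField.complexConj L) 3).Adelic) => φ (k : (quasiSplit (↥(maximalRealSubfield L)) L (IsCMField.complexConj L) 3).Adelic)) 2 μK :=
    MemLp.of_bound (hφc.comp continuous_subtype_val).aestronglyMeasurable Cφ (Eventually.of_forall fun k => hφC k)
  set bK : ι → Lp ℂ 2 μK := fun j => (hmem j).toLp _ with hbKdef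
  set φK : Lp ℂ 2 μK := hmemφ.toLp _ with hφKdef
  have hbK : ∀ j, ((bK j : Lp ℂ 2 μK) : ↥((standardMaximalCompactGL 3 L).comap (adelicVal (↥(maximalRealSubfield L)) L (IsCMField.complexConj L) 3 ((StdForm.antidiagonal 3).over L)) : Subgroup (quasiSplit (↥(maximalRealSubfield L)) L (IsCMField.complexConj L) 3).Adelic) → ℂ) =ᵐ[μK] fun k => φ' j (k : (quasiSplit (↥(maximalRealSubfield L)) L (IsCMField.complexConj L) 3).Adelic) := fun j => (hmem j).coeFn_toLp
  have hφK : ((φK : Lp ℂ 2 μK) : ↥((standardMaximalCompactGL 3 L).comap (adelicVal (↥(maximalRealSubfield L)) L (IsCMField.complexConj L) 3 ((StdForm.antidiagonal 3).over L)) : Subgroup (quasiSplit (↥(maximalRealSubfield L)) L (IsCMField.complexConj L) 3).Adelic) → ℂ) =ᵐ[μK] fun k => φ (k : (quasiSplit (↥(maximalRealSubfield L)) L (IsCMField.complexConj L) 3).Adelic) := hmemφ.coeFn_toLp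
  -- inner products as integrals
  have hG : ∀ j l, ⟪bK l, bK j⟫_ℂ = ∫ k, φ' j (k : (quasiSplit (↥(maximalRealSubfield L)) L (IsCMField.complexConj L) 3).Adelic) * conj (φ' l (k : (quasiSplit (↥(maximalRealSubfield L)) L (IsCMField.complexConj L) 3).Adelic)) ∂μK := fun j l => by
    rw [MeasureTheory.L2.inner_def]
    refine integral_congr_ae ?_
    filter_upwards [hbK j, hbK l] with k hj hl
    rw [RCLike.inner_apply, hj, hl]
  have hGφ : ∀ j, ⟪φK, bK j⟫_ℂ = ∫ k, φ' j (k : (quasiSplit (↥(maximalRealSubfield L)) L (IsCMField.complexConj L) 3).Adelic) * conj (φ (k : (quasiSplit (↥(maximalRealSubfield L)) L (IsCMField.complexConj L) 3).Adelic)) ∂μK := fun j => by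
    rw [MeasureTheory.L2.inner_def]
    refine integral_congr_ae ?_
    filter_upwards [hbK j, hφK] with k hj hφk
    rw [RCLike.inner_apply, hj, hφk]
  -- the norm of a class is the `L²`-norm of its representative
  have hnormsq : ∀ (u : Lp ℂ 2 μK) (g : ↥((standardMaximalCompactGL 3 L).comap (adelicVal (↥(maximalRealSubfield L)) L (IsCMField.complexConj L) 3 ((StdForm.antidiagonal 3).over L)) : Subgroup (quasiSplit (↥(maximalRealSubfield L)) L (IsCMField.complexConj L) 3).Adelic) → ℂ), ((u : Lp ℂ 2 μK) : ↥((standardMaximalCompactGL 3 L).comap (adelicVal (↥(maximalRealSubfield L)) L (IsCMField.complexConj L) 3 ((StdForm.antidiagonal 3).over L)) : Subgroup (quasiSplit (↥(maximalRealSubfield L)) L (IsCMField.complexConj L) 3).Adelic) → ℂ) =ᵐ[μK] g → ((‖u‖ ^ 2 : ℝ) : ℂ) = ((∫ k, ‖g k‖ ^ 2 ∂μK : ℝ) : ℂ) := by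
    intro u g hug
    have h1 : ((‖u‖ ^ 2 : ℝ) : ℂ) = ⟪u, u⟫_ℂ := by
      rw [inner_self_eq_norm_sq_to_K, Complex.ofReal_pow]; rfl
    rw [h1, MeasureTheory.L2.inner_def, ← integral_complex_ofReal]
    refine integral_congr_ae ?_
    filter_upwards [hug] with k hk
    rw [RCLike.inner_apply, hk, Complex.mul_conj, Complex.normSq_eq_norm_sq]
  -- the model section `ψ(q) = Σ_j q_j • bK_j` and its representative
  have hψrep : ∀ q : ι → ℂ, ((∑ j, q j • bK j : Lp ℂ 2 μK) : ↥((standardMaximalCompactGL 3 L).comap (adelicVal (↥(maximalRealSubfield L)) L (IsCMField.complexConj L) 3 ((StdForm.antidiagonal 3).over L)) : Subgroup (quasiSplit (↥(maximalRealSubfield L)) L (IsCMField.complexConj L) 3).Adelic) → ℂ) =ᵐ[μK] fun k => ∑ j, q j * φ' j (k : (quasiSplit (↥(maximalRealSubfield L)) L (IsCMField.complexConj L) 3).Adelic) :=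
    fun q => coeFn_sum_smul_ae Finset.univ q bK (fun j k => φ' j (k : (quasiSplit (↥(maximalRealSubfield L)) L (IsCMField.complexConj L) 3).Adelic)) hbK
  have hψnorm : ∀ q : ι → ℂ, ((‖∑ j, q j • bK j‖ ^ 2 : ℝ) : ℂ) = ((∫ k, ‖∑ j, q j * φ' j (k : (quasiSplit (↥(maximalRealSubfield L)) L (IsCMField.complexConj L) 3).Adelic)‖ ^ 2 ∂μK : ℝ) : ℂ) :=
    fun q => hnormsq _ _ (hψrep q)
  have hψnorm' : ∀ q : ι → ℂ, ‖∑ j, q j • bK j‖ ^ 2 = ∫ k, ‖∑ j, q j * φ' j (k : (quasiSplit (↥(maximalRealSubfield L)) L (IsCMField.complexConj L) 3).Adelic)‖ ^ 2 ∂μK := fun q => by exact_mod_cast hψnorm q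
  -- linear independence of the classes
  have hliK : LinearIndependent ℂ bK := by
    rw [Fintype.linearIndependent_iff]
    intro c hc
    have hae : (fun k : ↥((standardMaximalCompactGL 3 L).comap (adelicVal (↥(maximalRealSubfield L)) L (IsCMField.complexConj L) 3 ((StdForm.antidiagonal 3).over L)) : Subgroup (quasiSplit (↥(maximalRealSubfield L)) L (IsCMField.complexConj L) 3).Adelic) => ∑ j, c j * φ' j (k : (quasiSplit (↥(maximalRealSubfield L)) L (IsCMField.complexConj L) 3).Adelic)) =ᵐ[μK] 0 := by
      have hs := hψrep c
      rw [hc] at hs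
      filter_upwards [hs, Lp.coeFn_zero ℂ 2 μK] with k hk h0
      rw [h0] at hk
      exact hk.symm
    have hcont : Continuous fun k : ↥((standardMaximalCompactGL 3 L).comap (adelicVal (↥(maximalRealSubfield L)) L (IsCMField.complexConj L) 3 ((StdForm.antidiagonal 3).over L)) : Subgroup (quasiSplit (↥(maximalRealSubfield L)) L (IsCMField.complexConj L) 3).Adelic) => ∑ j, c j * φ' j (k : (quasiSplit (↥(maximalRealSubfield L)) L (IsCMField.complexConj L) 3).Adelic) :=
      continuous_finsetSum _ fun j _ => continuous_const.mul ((hφ'c j).comp continuous_subtype_val)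
    have h0 : (fun k : ↥((standardMaximalCompactGL 3 L).comap (adelicVal (↥(maximalRealSubfield L)) L (IsCMField.complexConj L) 3 ((StdForm.antidiagonal 3).over L)) : Subgroup (quasiSplit (↥(maximalRealSubfield L)) L (IsCMField.complexConj L) 3).Adelic) => ∑ j, c j * φ' j (k : (quasiSplit (↥(maximalRealSubfield L)) L (IsCMField.complexConj L) 3).Adelic)) = 0 := (Continuous.ae_eq_iff_eq μK hcont continuous_const).1 hae
    have h0' : ∑ j, c j • (fun (k : ↥((standardMaximalCompactGL 3 L).comap (adelicVal (↥(maximalRealSubfield L)) L (IsCMField.complexConj L) 3 ((StdForm.antidiagonal 3).over L)) : Subgroup (quasiSplit (↥(maximalRealSubfield L)) L (IsCMField.complexConj L) 3).Adelic)) => φ' j (k : (quasiSplit (↥(maximalRealSubfield L)) L (IsCMField.complexConj L) 3).Adelic)) = 0 := by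
      funext k
      have := congrFun h0 k
      simpa only [Finset.sum_apply, Pi.smul_apply, smul_eq_mul, Pi.zero_apply] using this
    exact Fintype.linearIndependent_iff.1 hli c h0'
  obtain ⟨C₀, hC₀, hdom⟩ := exists_norm_apply_le_norm_sum_smul hliK
  refine ⟨C₀ ^ 2, sq_nonneg _, fun q => ⟨?_, integral_nonneg fun k => sq_nonneg _, ?_, fun j => ?_⟩⟩
  · -- (i) the Gram form is `‖ψ(q)‖²`
    have h : (∑ j, ∑ l, q j * conj (q l) * ∫ k, φ' j (k : (quasiSplit (↥(maximalRealSubfield L)) L (IsCMField.complexConj L) 3).Adelic) * conj (φ' l (k : (quasiSplit (↥(maximalRealSubfield L)) L (IsCMField.complexConj L) 3).Adelic)) ∂μK) = ⟪∑ l, q l • bK l, ∑ j, q j • bK j⟫_ℂ := by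
      rw [sum_inner]
      simp_rw [inner_sum, inner_smul_left, inner_smul_right, hG]
      rw [Finset.sum_comm]
      refine Finset.sum_congr rfl fun j _ => Finset.sum_congr rfl fun l _ => ?_
      ring
    rw [h, inner_self_eq_norm_sq_to_K, ← hψnorm q, Complex.ofReal_pow]; rfl
  · -- (ii) Cauchy–Schwarz
    have h : (∑ j, q j * ∫ k, φ' j (k : (quasiSplit (↥(maximalRealSubfield L)) L (IsCMField.complexConj L) 3).Adelic) * conj (φ (k : (quasiSplit (↥(maximalRealSubfield L)) L (IsCMField.complexConj L) 3).Adelic)) ∂μK) = ⟪φK, ∑ j, q j • bK j⟫_ℂ := by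
      rw [inner_sum]
      simp_rw [inner_smul_right, hGφ]
    have hφnorm : ‖φK‖ ^ 2 = ∫ k, ‖φ (k : (quasiSplit (↥(maximalRealSubfield L)) L (IsCMField.complexConj L) 3).Adelic)‖ ^ 2 ∂μK := by exact_mod_cast hnormsq φK _ hφK
    rw [h, ← hφnorm, ← hψnorm' q]
    calc ‖⟪φK, ∑ j, q j • bK j⟫_ℂ‖ ^ 2 ≤ (‖φK‖ * ‖∑ j, q j • bK j‖) ^ 2 := by
          gcongr
          exact norm_inner_le_norm _ _
      _ = ‖φK‖ ^ 2 * ‖∑ j, q j • bK j‖ ^ 2 := by ring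
  · -- (iii) norm domination of the coordinates
    rw [← hψnorm' q]
    calc ‖q j‖ ^ 2 ≤ (C₀ * ‖∑ i, q i • bK i‖) ^ 2 := by
          gcongr
          exact hdom q j
      _ = C₀ ^ 2 * ‖∑ j, q j • bK j‖ ^ 2 := by ring

end L2Model

end Summit.HodgeConjecture.HodgeConjecture.R90.S8

end
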